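import Literature.MathematicalPhysics.QuantumFieldTheory.LatticeGaugeProofs
import Summits.QuantumFields.YangMills.Theorems.LangevinControlUVFemtoCurvatureTwoPointCTorusTopLink
import HarnessLib

/-!
# Route `LangevinControlUV`, crux `FemtoCurvatureTwoPointC` (stmt-QuantumFields-16204), line `birth` —
# the SHARP top-link assignment on the 4-torus (`#P = 3L⁴ − 3`)

Registered wave-7 sub-goal `torus_topLink_assignment_sharp` (`--supports stmt-QuantumFields-16204`),
proved verbatim. It sharpens the landed wave-3 `torus_topLink_assignment` (file `…CTorusTopLink`,
family of `3L⁴ − L³ − L² − L` plaquettes) to a family of `3L⁴ − 3` plaquettes, all else unchanged: an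
injective rank `rk` on the links of the torus `(ℤ/L)⁴`, `L ≥ 2`, and an assignment `top`, injective on
the family `P`, of a link of `p` of maximal rank among the four links `(x, μ)`, `(x + e_μ, ν)`,
`(x + e_ν, μ)`, `(x, ν)` of `p = (x; μ < ν)` (cf. `plaquetteHolonomy`).

**What it buys.** In the torus partition-function UPPER bound the links are integrated out from the
highest rank down and each `p ∈ P` contributes a one-link factor `z(β) ≤ C β^{−D/2}` (its top link is
nobody else's), so the exponent of the upper bound becomes `(D/2) #P = (D/2)(3L⁴ − 3)`, within
`(3/2) D` of the plaquette count `3L⁴` uniformly in `L`; the doubling estimate of the line then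
carries an `L`-independent slack `2D log β`, which is what the bulk regime `log β ≤ L⁴` of the
variance-ceiling stub on even tori needs.

**Why `3L⁴ − 3` is optimal.** `p ↦ top p` is a rank-decreasing, i.e. acyclic (discrete-Morse),
matching between plaquettes and links of the cubical complex of `T⁴ = (ℤ/L)⁴` with all `L⁴` sites
unmatched, so the strong Morse inequality `c₁ − c₀ ≥ b₁(T⁴) − b₀(T⁴) = 4 − 1` for `c₁ = 4L⁴ − #P`,
`c₀ = L⁴` gives `#P ≤ 3L⁴ − 3`. Below, the `L⁴ + 3` unassigned links are the `L⁴ − 1` links `(x, μ)`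
with `x_i = 0` (`i < μ`), `x_μ ≠ L − 1` (paired with the site `x + e_μ` in the full product Morse
matching on `C_L⁴`) and the `4 = b₁(T⁴)` critical wrap links `((L−1) e_μ, μ)`.

**The construction** (vocabulary `Site`/`Edge`/`Plaquette`/`Site.shift` of `ConstructiveQFTWave0`;
NO definitions — the three objects are produced inside the proof; coordinates read as naturals `< L`).
* Rank (`TopLinkSharp.exists_rank`): with `W = 2L`, `rk (x, μ) = Σᵢ dᵢ W^(3−i)`, digits
  `dᵢ = 2 xᵢ + [i = μ] < W`, coordinate `0` most significant (`finFunctionFinEquiv` after `Fin.rev`);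
  injective since the parity of digit `i` tells whether `i = μ`. Abstractly `rk (x, μ) = b x + w μ`
  with `w ν ≤ w μ` (`μ ≤ ν`), `b (x + e_μ) = b x + 2 w μ` if `x_μ ≠ L − 1`, `b (x + e_μ) ≤ b x` if
  `x_μ = L − 1` (the digit drops from `2L − 2` to `0`); only these four properties are used.
* Family `P = P_A ∪ P_B` (disjoint) and assignment, for `p = (x; μ < ν)`:
  `p ∈ P_A :⇔ x_μ ≠ L − 1 ∧ x_i = 0 (i < μ)`, `top p = (x + e_μ, ν)` — the landed bulk family
  (`TopLink.exists_boxes`/`injOn_top`/`card_family`: `#P_A + (L³ + L² + L) = 3L⁴`);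
  `p ∈ P_B :⇔ x_μ = L − 1 ∧ x_ν ≠ L − 1 ∧ x_i = 0 (i < ν, i ≠ μ)`, `top p = (x + e_ν, μ)` — the wrap
  plaquettes, assigned their lower-direction far link (`TopLinkSharp.exists_wrapBoxes`,
  `…card_wrapFamily`: `#P_B + 3 = L³ + L² + L`). `top` is the single map
  `p ↦ if x_μ + 1 < L then (x + e_μ, ν) else (x + e_ν, μ)`; maximal rank: `…rank_le_topA/B`
  (linear in `b x`, `b (x + e_μ)`, `b (x + e_ν)`, `w μ`, `w ν`); injectivity: `…injOn_top` (on `P_B`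
  and across the families a collision forces a coordinate `x_i + 1 = y_i = 0`, a wrap).

Proved from Mathlib and the public helpers of the landed `…CTorusTopLink` file; no named facts.
-/

set_option autoImplicit false

noncomputable section

open Finset
open Literature.MathematicalPhysics.QuantumFieldTheory

namespace Summit.QuantumFields.YangMills.Theorems.FemtoCurvatureTwoPointC.TorusGauge

namespace TopLinkSharp

open TopLink

variable {L : ℕ}

/-! ## Wrap-around arithmetic in `ZMod L` -/

/-- Wrap-around: if `a.val + 1 < L` fails (i.e. `a = L − 1`) then `a + 1 = 0` in `ZMod L`. -/
theorem add_one_eq_zero_of_not_lt [NeZero L] {a : ZMod L} (ha : ¬a.val + 1 < L) : a + 1 = 0 := by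
  have h1 : a.val + 1 = L := by have := ZMod.val_lt a; omega
  have h2 : ((a.val + 1 : ℕ) : ZMod L) = 0 := by rw [h1, ZMod.natCast_self]
  rwa [Nat.cast_add, Nat.cast_one, ZMod.natCast_zmod_val] at h2

/-- Coordinates (as naturals) of `x + e_μ` when the `μ`-th coordinate does not wrap: only the
`μ`-th one moves, by `+1`. -/
theorem val_shift_of_lt (hL : 2 ≤ L) (x : Site 4 L) (μ : Fin 4) (hx : (x μ).val + 1 < L)
    (i : Fin 4) : (x.shift μ i).val = (x i).val + if i = μ then 1 else 0 := by
  rw [shift_apply]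
  split_ifs with h
  · subst h
    exact val_add_one_of_lt hL hx
  · rw [add_zero, add_zero]

/-- Coordinates (as naturals) of `x + e_μ` when the `μ`-th coordinate wraps (`x_μ = L − 1`): the
`μ`-th one becomes `0`, the others do not move. -/
theorem val_shift_of_not_lt [NeZero L] (x : Site 4 L) (μ : Fin 4) (hx : ¬(x μ).val + 1 < L)
    (i : Fin 4) : (x.shift μ i).val = if i = μ then 0 else (x i).val := by
  rw [shift_apply]
  split_ifs with h
  · subst h
    rw [add_one_eq_zero_of_not_lt hx, ZMod.val_zero]
  · rw [add_zero]

/-! ## The rank: coordinate-0-major, doubled digits, links offset by one -/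

/-- **The rank data.** For `L ≥ 2` there are a base-point code `b : Site → ℕ` and direction weights
`w : Fin 4 → ℕ` (namely `b x = Σᵢ 2 xᵢ W^(3−i)`, `w μ = W^(3−μ)`, `W = 2L`) such that the rank
`rk (x, μ) = b x + w μ` — the `W`-adic integer with digits `2 xᵢ + [i = μ]`, coordinate `0` most
significant — is injective on links, the weights are antitone in the direction, a non-wrapping
shift in direction `μ` raises the code by `2 w μ`, and a wrapping shift does not raise it. -/
theorem exists_rank [NeZero L] (hL : 2 ≤ L) : ∃ (b : Site 4 L → ℕ) (w : Fin 4 → ℕ),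
    (Function.Injective fun e : Edge 4 L => b e.1 + w e.2) ∧
    (∀ μ ν : Fin 4, μ ≤ ν → w ν ≤ w μ) ∧
    (∀ (x : Site 4 L) (μ : Fin 4), (x μ).val + 1 < L → b (x.shift μ) = b x + 2 * w μ) ∧
    (∀ (x : Site 4 L) (μ : Fin 4), ¬(x μ).val + 1 < L → b (x.shift μ) ≤ b x) := by
  -- the digit string `dg` of a link, least significant first: digit `i` reads coordinate `3 - i`
  have hlt : ∀ (a : ZMod L) (μ ν : Fin 4), 2 * a.val + (if μ = ν then 1 else 0) < 2 * L :=
    fun a μ ν => by have := ZMod.val_lt a; split_ifs <;> omega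
  obtain ⟨dg, hdg⟩ : ∃ dg : Edge 4 L → Fin 4 → Fin (2 * L), ∀ e i,
      ((dg e i : Fin (2 * L)) : ℕ) = 2 * (e.1 (Fin.rev i)).val + if Fin.rev i = e.2 then 1 else 0 :=
    ⟨fun e i => ⟨_, hlt (e.1 (Fin.rev i)) (Fin.rev i) e.2⟩, fun _ _ => rfl⟩
  have hdg_inj : Function.Injective dg := by
    rintro ⟨x, μ⟩ ⟨y, ν⟩ h
    have hd : ∀ i : Fin 4,
        2 * (x i).val + (if i = μ then 1 else 0) = 2 * (y i).val + if i = ν then 1 else 0 := by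
      intro i
      have := congrArg (fun f : Fin 4 → Fin (2 * L) => ((f (Fin.rev i) : Fin (2 * L)) : ℕ)) h
      simpa only [hdg, Fin.rev_rev] using this
    have hμν : μ = ν := by
      by_contra hne; have := hd μ; rw [if_pos rfl, if_neg hne] at this; omega
    subst hμν
    have hxy : x = y := funext fun i => ZMod.val_injective L (by
      have := hd i
      split_ifs at this <;> omega)
    rw [hxy]
  have hrk : ∀ e : Edge 4 L, ((finFunctionFinEquiv (dg e) : Fin ((2 * L) ^ 4)) : ℕ) =
      ∑ i : Fin 4, 2 * (e.1 (Fin.rev i)).val * (2 * L) ^ (i : ℕ) + (2 * L) ^ (Fin.rev e.2 : ℕ) :=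
    fun e => by simp only [finFunctionFinEquiv_apply, hdg, add_mul, Finset.sum_add_distrib, ite_mul,
      one_mul, zero_mul, Fin.rev_eq_iff, Finset.sum_ite_eq', Finset.mem_univ, if_true]
  refine ⟨fun x => ∑ i : Fin 4, 2 * (x (Fin.rev i)).val * (2 * L) ^ (i : ℕ),
    fun μ => (2 * L) ^ (Fin.rev μ : ℕ), fun e e' h => ?_, fun μ ν h => ?_, fun x μ hx => ?_,
    fun x μ hx => ?_⟩
  · -- injectivity: `b e.1 + w e.2` is the `W`-adic number with digit string `dg e`
    exact hdg_inj (finFunctionFinEquiv.injective (Fin.ext (by rw [hrk, hrk]; exact h)))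
  · exact Nat.pow_le_pow_right (by omega) (Fin.rev_le_rev.2 h)
  · simp only [val_shift_of_lt hL x μ hx, mul_add, add_mul, Finset.sum_add_distrib, mul_ite,
      mul_one, mul_zero, ite_mul, zero_mul, Fin.rev_eq_iff, Finset.sum_ite_eq', Finset.mem_univ,
      if_true]
  · refine Finset.sum_le_sum fun i _ => ?_
    rw [val_shift_of_not_lt x μ hx]
    split_ifs <;> simp

/-! ## Maximal rank of the assigned link among the four links of its plaquette -/

/-- **Maximal rank, bulk plaquettes.** For a plaquette `p = (x; μ < ν)` whose `μ`-th coordinate does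
not wrap, each of its four links `(x, μ)`, `(x + e_μ, ν)`, `(x + e_ν, μ)`, `(x, ν)` has rank
`b · + w ·` at most that of `(x + e_μ, ν)`. -/
theorem rank_le_topA {b : Site 4 L → ℕ} {w : Fin 4 → ℕ} (hw : ∀ μ ν : Fin 4, μ ≤ ν → w ν ≤ w μ)
    (hshift : ∀ (x : Site 4 L) (μ : Fin 4), (x μ).val + 1 < L → b (x.shift μ) = b x + 2 * w μ)
    (hwrap : ∀ (x : Site 4 L) (μ : Fin 4), ¬(x μ).val + 1 < L → b (x.shift μ) ≤ b x)
    {p : Plaquette 4 L} (hp : (p.1 p.2.1.1).val + 1 < L) :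
    ∀ e ∈ ({(p.1, p.2.1.1), (p.1.shift p.2.1.1, p.2.1.2), (p.1.shift p.2.1.2, p.2.1.1),
      (p.1, p.2.1.2)} : Finset (Edge 4 L)), b e.1 + w e.2 ≤ b (p.1.shift p.2.1.1) + w p.2.1.2 := by
  obtain ⟨x, ⟨⟨μ, ν⟩, hμν⟩⟩ := p
  have hA : b (x.shift μ) = b x + 2 * w μ := hshift x μ hp
  have hνμ : w ν ≤ w μ := hw μ ν hμν.le
  intro e he
  simp only [Finset.mem_insert, Finset.mem_singleton] at he
  rcases he with rfl | rfl | rfl | rfl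
  · show b x + w μ ≤ b (x.shift μ) + w ν; omega
  · exact le_rfl
  · show b (x.shift ν) + w μ ≤ b (x.shift μ) + w ν
    by_cases hν : (x ν).val + 1 < L
    · have := hshift x ν hν; omega
    · have := hwrap x ν hν; omega
  · show b x + w ν ≤ b (x.shift μ) + w ν; omega

/-- **Maximal rank, wrap plaquettes.** For a plaquette `p = (x; μ < ν)` whose `μ`-th coordinate
wraps (`x_μ = L − 1`) but whose `ν`-th does not, each of its four links has rank `b · + w ·` at most
that of `(x + e_ν, μ)`. -/
theorem rank_le_topB {b : Site 4 L → ℕ} {w : Fin 4 → ℕ}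
    (hshift : ∀ (x : Site 4 L) (μ : Fin 4), (x μ).val + 1 < L → b (x.shift μ) = b x + 2 * w μ)
    (hwrap : ∀ (x : Site 4 L) (μ : Fin 4), ¬(x μ).val + 1 < L → b (x.shift μ) ≤ b x)
    {p : Plaquette 4 L} (hp : ¬(p.1 p.2.1.1).val + 1 < L) (hp' : (p.1 p.2.1.2).val + 1 < L) :
    ∀ e ∈ ({(p.1, p.2.1.1), (p.1.shift p.2.1.1, p.2.1.2), (p.1.shift p.2.1.2, p.2.1.1),
      (p.1, p.2.1.2)} : Finset (Edge 4 L)), b e.1 + w e.2 ≤ b (p.1.shift p.2.1.2) + w p.2.1.1 := by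
  obtain ⟨x, ⟨⟨μ, ν⟩, hμν⟩⟩ := p
  have hB : b (x.shift ν) = b x + 2 * w ν := hshift x ν hp'
  have hμ : b (x.shift μ) ≤ b x := hwrap x μ hp
  intro e he
  simp only [Finset.mem_insert, Finset.mem_singleton] at he
  rcases he with rfl | rfl | rfl | rfl
  · show b x + w μ ≤ b (x.shift ν) + w μ; omega
  · show b (x.shift μ) + w ν ≤ b (x.shift ν) + w μ; omega
  · exact le_rfl
  · show b x + w ν ≤ b (x.shift ν) + w μ; omega

/-! ## Injectivity of the assignment -/

/-- If `x + e_μ = y + e_ν` with `μ ≠ ν` and no wrap at `x_μ`, then `y_μ ≠ 0` (evaluate at `μ`: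
`y_μ = x_μ + 1` has value `x_μ + 1 ≠ 0`). -/
theorem apply_ne_zero_of_shift_eq (hL : 2 ≤ L) {x y : Site 4 L} {μ ν : Fin 4}
    (hx : (x μ).val + 1 < L) (hne : μ ≠ ν) (h : x.shift μ = y.shift ν) : y μ ≠ 0 := by
  intro hy
  have h1 := congrFun h μ
  rw [shift_apply, shift_apply, if_pos rfl, if_neg hne, add_zero, hy] at h1
  have h2 := congrArg ZMod.val h1
  rw [val_add_one_of_lt hL hx, ZMod.val_zero] at h2
  exact Nat.succ_ne_zero _ h2

/-- **No collision between the two families.** The top link `(x + e_μ, ν)` of a bulk plaquette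
`(x; μ < ν)` (no wrap at `x_μ`) is never the top link `(y + e_{ν'}, μ')` of a wrap plaquette
`(y; μ' < ν')` (with `y_i = 0` for `i < ν'`, `i ≠ μ'`): the directions force `μ < ν = μ' < ν'`, and
evaluating the sites at `μ` gives `x_μ + 1 = y_μ = 0`, a wrap. -/
theorem topA_ne_topB (hL : 2 ≤ L) {p q : Plaquette 4 L} (hp : (p.1 p.2.1.1).val + 1 < L)
    (hq : ∀ i : Fin 4, i < q.2.1.2 → i ≠ q.2.1.1 → q.1 i = 0) :
    (p.1.shift p.2.1.1, p.2.1.2) ≠ (q.1.shift q.2.1.2, q.2.1.1) := by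
  obtain ⟨x, ⟨⟨μ, ν⟩, hμν⟩⟩ := p
  obtain ⟨y, ⟨⟨μ', ν'⟩, hμν'⟩⟩ := q
  intro h
  obtain ⟨h1, h2⟩ := Prod.mk.inj h
  subst h2
  exact apply_ne_zero_of_shift_eq hL hp (hμν.trans hμν').ne h1 (hq μ (hμν.trans hμν') hμν.ne)

/-- **Injectivity on the wrap family.** The assignment `(x; μ, ν) ↦ (x + e_ν, μ)` is injective on
the plaquettes `(x; μ < ν)` with `x_μ = L − 1`, `x_ν ≠ L − 1` and `x_i = 0` for `i < ν`, `i ≠ μ`: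
equal images have equal `μ`; if `ν < ν'`, evaluating the sites at `ν` gives `x_ν + 1 = y_ν = 0`, a
wrap; so `ν = ν'` and the sites cancel. -/
theorem injOn_topB [NeZero L] (hL : 2 ≤ L) {C : Fin 4 → Fin 4 → Finset (Site 4 L)}
    (hC : ∀ (μ ν : Fin 4) (x : Site 4 L), μ < ν → (x ∈ C μ ν ↔
      ¬(x μ).val + 1 < L ∧ (x ν).val + 1 < L ∧ ∀ i : Fin 4, i < ν → i ≠ μ → x i = 0)) :
    Set.InjOn (fun p : Plaquette 4 L => (p.1.shift p.2.1.2, p.2.1.1))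
      ↑(univ.filter fun p : Plaquette 4 L => p.1 ∈ C p.2.1.1 p.2.1.2) := by
  rintro ⟨x, ⟨⟨μ, ν⟩, hμν⟩⟩ hx ⟨y, ⟨⟨μ', ν'⟩, hμν'⟩⟩ hy h
  simp only [Finset.coe_filter, Finset.mem_univ, true_and, Set.mem_setOf_eq] at hx hy
  rw [hC _ _ _ hμν] at hx
  rw [hC _ _ _ hμν'] at hy
  obtain ⟨h1, h2⟩ := Prod.mk.inj h
  subst h2
  have hν : ν = ν' := by
    by_contra hne
    rcases lt_or_gt_of_ne hne with hlt | hlt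
    · exact apply_ne_zero_of_shift_eq hL hx.2.1 hne h1 (hy.2.2 ν hlt hμν.ne')
    · exact apply_ne_zero_of_shift_eq hL hy.2.1 (Ne.symm hne) h1.symm (hx.2.2 ν' hlt hμν'.ne')
  subst hν
  have hxy : x = y := add_right_cancel (h1 : x + Pi.single ν 1 = y + Pi.single ν 1)
  subst hxy
  rfl

/-- **Injectivity of the combined assignment** `top (x; μ, ν) = (x + e_μ, ν)` if `x_μ ≠ L − 1`, else
`(x + e_ν, μ)`, on the union of the bulk family (the landed `TopLink.injOn_top`) and the wrap family
(`TopLinkSharp.injOn_topB`); mixed collisions are excluded by `TopLinkSharp.topA_ne_topB`. -/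
theorem injOn_top [NeZero L] (hL : 2 ≤ L) {B : Fin 4 → Finset (Site 4 L)}
    {C : Fin 4 → Fin 4 → Finset (Site 4 L)}
    (hB : ∀ (μ : Fin 4) (x : Site 4 L), x ∈ B μ ↔ (x μ).val + 1 < L ∧ ∀ i : Fin 4, i < μ → x i = 0)
    (hC : ∀ (μ ν : Fin 4) (x : Site 4 L), μ < ν → (x ∈ C μ ν ↔
      ¬(x μ).val + 1 < L ∧ (x ν).val + 1 < L ∧ ∀ i : Fin 4, i < ν → i ≠ μ → x i = 0)) :
    Set.InjOn (fun p : Plaquette 4 L => if (p.1 p.2.1.1).val + 1 < L then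
        (p.1.shift p.2.1.1, p.2.1.2) else (p.1.shift p.2.1.2, p.2.1.1))
      ↑((univ.filter fun p : Plaquette 4 L => p.1 ∈ B p.2.1.1) ∪
        (univ.filter fun p : Plaquette 4 L => p.1 ∈ C p.2.1.1 p.2.1.2)) := by
  have hA' : ∀ p ∈ (univ.filter fun p : Plaquette 4 L => p.1 ∈ B p.2.1.1),
      (p.1 p.2.1.1).val + 1 < L := fun p hp => ((hB _ _).1 (Finset.mem_filter.1 hp).2).1
  have hB' : ∀ p ∈ (univ.filter fun p : Plaquette 4 L => p.1 ∈ C p.2.1.1 p.2.1.2),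
      ¬(p.1 p.2.1.1).val + 1 < L ∧ (p.1 p.2.1.2).val + 1 < L ∧
        ∀ i : Fin 4, i < p.2.1.2 → i ≠ p.2.1.1 → p.1 i = 0 :=
    fun p hp => (hC _ _ _ p.2.2).1 (Finset.mem_filter.1 hp).2
  intro p hp q hq h
  rw [Finset.coe_union, Set.mem_union, Finset.mem_coe, Finset.mem_coe] at hp hq
  rcases hp with hp | hp <;> rcases hq with hq | hq
  · simp only [if_pos (hA' p hp), if_pos (hA' q hq)] at h
    exact TopLink.injOn_top hL hB hp hq h
  · simp only [if_pos (hA' p hp), if_neg (hB' q hq).1] at h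
    exact absurd h (topA_ne_topB hL (hA' p hp) (hB' q hq).2.2)
  · simp only [if_neg (hB' p hp).1, if_pos (hA' q hq)] at h
    exact absurd h.symm (topA_ne_topB hL (hA' q hq) (hB' p hp).2.2)
  · simp only [if_neg (hB' p hp).1, if_neg (hB' q hq).1] at h
    exact injOn_topB hL hC hp hq h

/-! ## The wrap family: boxes of base points and the count -/

variable [NeZero L]

/-- There is exactly one residue mod `L` whose value is `L − 1`. -/
theorem card_filter_not_val_succ_lt : (univ.filter fun a : ZMod L => ¬a.val + 1 < L).card = 1 := by
  have h := Finset.card_filter_add_card_filter_not (s := (univ : Finset (ZMod L)))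
    (fun a : ZMod L => a.val + 1 < L)
  rw [card_filter_val_succ_lt, Finset.card_univ, ZMod.card] at h
  have := NeZero.ne L
  omega

/-- **The boxes of the wrap family.** For directions `μ < ν` the base points `x` with `x_μ = L − 1`,
`x_ν ≠ L − 1` (as naturals: `¬ x_μ + 1 < L`, `x_ν + 1 < L`) and `x_i = 0` for `i < ν`, `i ≠ μ` form
a box (`Fintype.piFinset`) of size `∏ᵢ #slotᵢ` with `#slotᵢ = 1` (`i = μ`), `L − 1` (`i = ν`), `1`
(other `i < ν`), `L` (`i > ν`). -/
theorem exists_wrapBoxes : ∃ C : Fin 4 → Fin 4 → Finset (Site 4 L),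
    (∀ (μ ν : Fin 4) (x : Site 4 L), μ < ν → (x ∈ C μ ν ↔
      ¬(x μ).val + 1 < L ∧ (x ν).val + 1 < L ∧ ∀ i : Fin 4, i < ν → i ≠ μ → x i = 0)) ∧
    ∀ μ ν : Fin 4, μ < ν → (C μ ν).card =
      ∏ i : Fin 4, (if i = μ then 1 else if i = ν then L - 1 else if i < ν then 1 else L) := by
  refine ⟨fun μ ν => Fintype.piFinset fun i =>
      if i = μ then univ.filter (fun a : ZMod L => ¬a.val + 1 < L) else
      if i = ν then univ.filter (fun a : ZMod L => a.val + 1 < L) else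
      if i < ν then {0} else univ, fun μ ν x hμν => ?_, fun μ ν hμν => ?_⟩
  · rw [Fintype.mem_piFinset]
    constructor
    · intro h
      exact ⟨by simpa using h μ, by simpa [hμν.ne'] using h ν,
        fun i hi hiμ => by simpa [hiμ, hi.ne, hi] using h i⟩
    · rintro ⟨h1, h2, h3⟩ i
      split_ifs with hiμ hiν hi
      · subst hiμ
        exact Finset.mem_filter.2 ⟨Finset.mem_univ _, h1⟩
      · subst hiν
        exact Finset.mem_filter.2 ⟨Finset.mem_univ _, h2⟩
      · exact Finset.mem_singleton.2 (h3 i hi hiμ)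
      · exact Finset.mem_univ _
  · rw [Fintype.card_piFinset]
    refine Finset.prod_congr rfl fun i _ => ?_
    split_ifs with hiμ hiν hi
    · exact card_filter_not_val_succ_lt
    · exact card_filter_val_succ_lt
    · rfl
    · rw [Finset.card_univ, ZMod.card]

/-- **Count of the wrap family.** If the box for directions `μ < ν` has `∏ᵢ #slotᵢ` elements
(`1`, `L − 1`, `1`, `L` for `i = μ`, `i = ν`, other `i < ν`, `i > ν`), the wrap family has
`(L−1) L² + 2 (L−1) L + 3 (L−1) = L³ + L² + L − 3` members: `#P_B + 3 = L³ + L² + L`. -/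
theorem card_wrapFamily {C : Fin 4 → Fin 4 → Finset (Site 4 L)}
    (hC : ∀ μ ν : Fin 4, μ < ν → (C μ ν).card =
      ∏ i : Fin 4, (if i = μ then 1 else if i = ν then L - 1 else if i < ν then 1 else L)) :
    (univ.filter fun p : Plaquette 4 L => p.1 ∈ C p.2.1.1 p.2.1.2).card + 3 =
      L ^ 3 + L ^ 2 + L := by
  have h1 : (univ.filter fun p : Plaquette 4 L => p.1 ∈ C p.2.1.1 p.2.1.2).card =
      ∑ q : {q : Fin 4 × Fin 4 // q.1 < q.2}, ∏ i : Fin 4,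
        (if i = q.1.1 then 1 else if i = q.1.2 then L - 1 else if i < q.1.2 then 1 else L) := by
    calc (univ.filter fun p : Plaquette 4 L => p.1 ∈ C p.2.1.1 p.2.1.2).card
          = ∑ p : Plaquette 4 L, if p.1 ∈ C p.2.1.1 p.2.1.2 then 1 else 0 := Finset.card_filter _ _
      _ = ∑ q : {q : Fin 4 × Fin 4 // q.1 < q.2}, ∑ x : Site 4 L,
            if x ∈ C q.1.1 q.1.2 then 1 else 0 := Fintype.sum_prod_type_right _
      _ = ∑ q : {q : Fin 4 × Fin 4 // q.1 < q.2}, (C q.1.1 q.1.2).card :=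
          Finset.sum_congr rfl fun q _ => by rw [Finset.sum_ite_mem_eq, Finset.card_eq_sum_ones]
      _ = _ := Finset.sum_congr rfl fun q _ => hC _ _ q.2
  rw [h1, ← Finset.sum_subtype (p := fun q : Fin 4 × Fin 4 => q.1 < q.2)
    (univ.filter fun q : Fin 4 × Fin 4 => q.1 < q.2) (fun _ => by simp)
    (fun q : Fin 4 × Fin 4 => ∏ i : Fin 4,
      (if i = q.1 then 1 else if i = q.2 then L - 1 else if i < q.2 then 1 else L)),
    Finset.sum_filter]
  simp only [Fintype.sum_prod_type, Fin.sum_univ_four, Fin.prod_univ_four]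
  simp
  obtain ⟨M, rfl⟩ : ∃ M, L = M + 1 := ⟨L - 1, (Nat.succ_pred_eq_of_ne_zero (NeZero.ne L)).symm⟩
  simp only [Nat.add_sub_cancel]
  ring

end TopLinkSharp

/-! ## The registered statement -/

/-- **Sharp top-link assignment on the 4-torus.** For `L ≥ 2` there are a family `P` of `3L⁴ − 3`
plaquettes of the torus `(ℤ/L)⁴`, a map `top` assigning to each of them one of its four links, and an
injective rank on links such that `top` is injective on `P` and `top p` has maximal rank among the
four links of `p`. (Rank: the `2L`-adic integer with digits `2 xᵢ + [i = μ]`, coordinate `0` most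
significant; family: bulk plaquettes `(x; μ < ν)`, `x_μ ≠ L − 1`, `x_i = 0` (`i < μ`), assigned
`(x + e_μ, ν)`, and wrap plaquettes, `x_μ = L − 1`, `x_ν ≠ L − 1`, `x_i = 0` (`i < ν`, `i ≠ μ`),
assigned `(x + e_ν, μ)`; see the module docstring and the namespace `TopLinkSharp`.) -/
theorem torus_topLink_assignment_sharp : ∀ (L : ℕ) [NeZero L], 2 ≤ L →
    ∃ (P : Finset (Plaquette 4 L)) (top : Plaquette 4 L → Edge 4 L) (rk : Edge 4 L → ℕ),
      Function.Injective rk ∧ Set.InjOn top ↑P ∧ P.card + 3 = 3 * L ^ 4 ∧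
      ∀ p ∈ P,
        top p ∈ ({(p.1, p.2.1.1), (p.1.shift p.2.1.1, p.2.1.2), (p.1.shift p.2.1.2, p.2.1.1), (p.1, p.2.1.2)} :
          Finset (Edge 4 L)) ∧
        ∀ e ∈ ({(p.1, p.2.1.1), (p.1.shift p.2.1.1, p.2.1.2), (p.1.shift p.2.1.2, p.2.1.1), (p.1, p.2.1.2)} :
          Finset (Edge 4 L)), rk e ≤ rk (top p) := by
  intro L _ hL
  obtain ⟨b, w, hrk, hw, hshift, hwrap⟩ := TopLinkSharp.exists_rank (L := L) hL
  obtain ⟨B, hB_mem, hB_card⟩ := TopLink.exists_boxes (L := L)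
  obtain ⟨C, hC_mem, hC_card⟩ := TopLinkSharp.exists_wrapBoxes (L := L)
  refine ⟨(univ.filter fun p : Plaquette 4 L => p.1 ∈ B p.2.1.1) ∪
      (univ.filter fun p : Plaquette 4 L => p.1 ∈ C p.2.1.1 p.2.1.2),
    fun p => if (p.1 p.2.1.1).val + 1 < L then (p.1.shift p.2.1.1, p.2.1.2)
      else (p.1.shift p.2.1.2, p.2.1.1),
    fun e => b e.1 + w e.2, hrk, TopLinkSharp.injOn_top hL hB_mem hC_mem, ?_, fun p hp => ⟨?_, ?_⟩⟩
  · -- the count `#P_A + #P_B + 3 = 3L⁴` (the families are disjoint: `x_μ ≠ L − 1` vs `x_μ = L − 1`)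
    rw [Finset.card_union_of_disjoint (Finset.disjoint_left.2 fun p hpA hpB =>
      ((hC_mem _ _ _ p.2.2).1 (Finset.mem_filter.1 hpB).2).1
        ((hB_mem _ _).1 (Finset.mem_filter.1 hpA).2).1)]
    have h1 := TopLink.card_family hB_card
    have h2 := TopLinkSharp.card_wrapFamily hC_card
    omega
  · -- `top p` is a link of `p`
    dsimp only
    split_ifs <;> simp
  · -- `top p` has maximal rank among the links of `p`
    dsimp only
    by_cases h : (p.1 p.2.1.1).val + 1 < L
    · rw [if_pos h]
      exact TopLinkSharp.rank_le_topA hw hshift hwrap h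
    · rw [if_neg h]
      have hpB := (Finset.mem_union.1 hp).resolve_left fun hpA =>
        h ((hB_mem _ _).1 (Finset.mem_filter.1 hpA).2).1
      exact TopLinkSharp.rank_le_topB hshift hwrap h
        ((hC_mem _ _ _ p.2.2).1 (Finset.mem_filter.1 hpB).2).2.1

end Summit.QuantumFields.YangMills.Theorems.FemtoCurvatureTwoPointC.TorusGauge

end
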